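import Summits.HodgeConjecture.HodgeConjecture.Theorems.Ring2ClassTargetsRowsSixSeven
import Summits.HodgeConjecture.HodgeConjecture.Theorems.Ring2AtlasSixfolds
import Summits.HodgeConjecture.Ring2.RowFourClosed
import Summits.HodgeConjecture.HodgeConjecture.Theorems.WeilTypeLadderOnPath
import Summits.HodgeConjecture.CorCM.SimpleCMSixfoldHodgeOfSplitWeilSixfolds
import HarnessLib

/-!
# TABLE X (dimension 6) — the cover theorem: HC for every complex abelian sixfold outside the residue
# classes, from the dimension-6 Hodge-class census (cell `pub-hodgeav-hg6`, req-37 (A) Q2b; lead g0, SKETCH)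

HONEST FRAMING. HC, `HC_AV` (stmt-1333), `HC_CM` (`Theses.RankFourFaces.CMAbelianHodge`, stmt-3052) and the rung H2
(`Theses.SevenfoldWeilCensus.WeilSixfolds`, stmt-2524) are NOT proved; they occur below only as HYPOTHESES BY NAME.
The two census statements `SixfoldCodimTwoCensus` / `SixfoldCodimThreeCensus` are OURS (the content of TABLE X,
`run/shared/lean/pub/pub-hodgeav-hg6/TABLE-X-g6-v0.md`: every simple sixfold's Hodge group and every non-simple
non-CM sixfold by interaction type, 2–8 independent engines per entry, cell `pub-hodge-ring2` AV-HODGE-ATLAS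
§4/§10/§14/§22–§24) — conjecture nodes with a machine dossier, NOT Literature facts and NOT asserted. KERNEL ONLY:
two definitions (the census nodes, `@[conjecture]`) and theorems; no `sorry`, no new named fact.

WHAT IS PROVED. `hcAtDim_six_of_tableX`: GRANTED (1) Markman's fourfold theorem (named fact
`Markman2025_weilClasses_algebraic_abelianFourfold`, which alone gives the floor `HCUpToDim 5`,
`Ring2.RowFourClosed.hcUpToDim_five_of_markman`), (2) the displayed binder `HC_CM`, (3) HC on the K3-partner cell
`Ring2.Atlas.HodgeQuarticTypeIVFourfoldTimesCMSurface` (OPEN, residue R-K3P), (4) the Weil classes of abelian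
sixfolds `WeilSixfolds` (OPEN off the hyperbolic components = residue R-W6 = rung H2; the hyperbolic components are
Markman Thm. 1.5.1 / Schoen / Koike), and (5)–(6) the two dimension-6 census nodes OFF the residue class
`CM ∪ K3P` (CM abelian varieties, and the K3-partner products `Y × Z`, `Y` a simple type-IV fourfold with quartic
field, `Z` a CM surface — atlas rows `g6.S_ExY4_E.cyclic`, `.D4.aligned`, `g6.Ek1xEk2xY4_E.biquad`; the class is
written inline as `fun A ↦ IsOfCMType A ∨ ProdCMCell IsQuarticFieldTypeIVFourfold (dim = 2) A`) — the Hodge conjecture holds for every complex abelian variety of dimension `6`. The proof is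
`Ring2.ClassTargets.mem_algebraicClasses_of_dim_le_seven_of_censusOff` re-run with the bound `6` (so that the census is
demanded at dimension `6` only), then instantiated. `hcAtDim_six_of_tableX_residues` SPLITS hypothesis (4) into
its printed part (Markman Thm. 1.5.1: the hyperbolic = split = discriminant `-1` components, named fact
`Markman2025_weilClasses_algebraic_hyperbolicSixfold`, UNREFEREED; Schoen `ℚ(√-3)` / Koike `ℚ(i)` are its refereed
instances) and the RESIDUE R-W6 proper = the existing rung `WeilTypeLadder.NonsplitSixfolds` (Weil classes on the
sixfolds admitting NO hyperbolic `K`-symmetrised hyperplane class; OPEN, nothing in print for any `K`), through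
`WeilTypeLadder.weilSixfolds_of_nonsplitSixfolds_of_floor`. So, literally: HC in dimension `6` ⟸ {two Markman facts
(print), `HC_CM` (binder), R-K3P, R-W6 = `NonsplitSixfolds`, TABLE X (two census nodes)}.

v3 (2026-08-28, TABLE X row 15). The induction of §1 demands HC on the granted class `𝒞` AT DIMENSION `6` ONLY
(`HCOnClass fun A ↦ 𝒞 A ∧ A.dim = 6`; smaller dimensions are the floor). This lets the binder `HC_CM` be NARROWED:
`hcAtDim_six_of_tableX_cmSplit` replaces it by (a) HC for the SIMPLE complex abelian sixfolds of CM type, which the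
tree derives (`CorCM.CMSixfoldSplit.hodgeSimpleCMSixfold_of_markmanSixfolds_of_cmSplit`, cell COR-CM) from Markman's
hyperbolic-sixfold statement and the displayed CM-SPLITNESS hypothesis `hS` (every `(3,3)` Weil structure on a simple CM
sixfold admits a `k`-symmetrised hyperplane class of SPLIT discriminant; print-level proof = the COR-CM note
"CM-WEIL-SPLIT" Theorem A, O'Meara 71:19, NOT refereed, NOT a kernel theorem — copied here VERBATIM as an inline
hypothesis, no definition), and (b) the displayed binder `HC` for the NON-SIMPLE complex abelian sixfolds of CM type
(TABLE X row 29: interacting CM products, e.g. `B × E′ × E″` with `exc₂ = 4`). So: HC in dimension `6` ⟸ {Markman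
fourfolds, Markman hyperbolic sixfolds (print, the latter UNREFEREED), CM-splitness `hS` (note-level), HC for non-simple
CM sixfolds (binder), R-K3P, R-W6 = `NonsplitSixfolds`, TABLE X (two census nodes)}. `HC_CM` is NOT proved; the
narrowed binder is displayed, never asserted.
-/

set_option linter.dupNamespace false

noncomputable section

open CategoryTheory
open Literature.AlgebraicGeometry Literature.AlgebraicGeometry.Motives
open Literature.AlgebraicGeometry.HodgeTheory
open Literature.AlgebraicGeometry.Milne1999
open Literature.AlgebraicTopology.SingularHomology
open Literature.Barriers.HodgeConjecture
open Summit.HodgeConjecture.HodgeConjecture.Ring2.ClassTargets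
open Summit.HodgeConjecture.HodgeConjecture.Ring2.Motiv (ProdCMCell)
open Summit.HodgeConjecture.HodgeConjecture.Ring2.Atlas (IsQuarticFieldTypeIVFourfold
  HodgeQuarticTypeIVFourfoldTimesCMSurface IsSimpleCMSixfold)
open Summit.HodgeConjecture.HodgeConjecture.Ring2.Hypotheses (splitDiscriminantClass)
open Literature.AlgebraicGeometry.VanGeemen1994 (HasWeilDiscriminantNondeg)

namespace Summit.HodgeConjecture.HodgeConjecture.TableX

/-- **TABLE X, codimension 2 (census node, OURS, dimension 6 only):** on every complex abelian SIXFOLD outside the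
residue class every rational `(2,2)`-class lies in the span of divisor monomials and of pull-backs of rational
`(2,2)`-classes of abelian varieties of smaller dimension. Evidence: TABLE-X-g6-v0 rows 1–13, 16–22, 25, 27, 28
(`exc₂ = 0` or fourfold-Weil pull-backs), 2–8 engines each. A definition (nothing asserted).
[cite: MoonenZarhin1999LowDim, Thm. 0.1 and §5] [status: open] -/
@[conjecture] def SixfoldCodimTwoCensus : Prop :=
  ∀ A : AbelianVariety ℂ, A.dim = 6 → ¬ (IsOfCMType A ∨ ProdCMCell IsQuarticFieldTypeIVFourfold (fun Z ↦ Z.dim = 2) A) → ∀ c : complexBetti A.X (2 * 2),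
    IsRationalClass c → IsOfHodgeType A.dim A.X (2 * 2) 2 2 c →
      c ∈ divisorClassesSpan A.X A.dim 2 ⊔ Submodule.span ℂ {w' : complexBetti A.X (2 * 2) |
        ∃ (C : AbelianVariety ℂ) (g : A.X ⟶ C.X) (w : complexBetti C.X (2 * 2)), C.dim < A.dim ∧
          IsRationalClass w ∧ IsOfHodgeType C.dim C.X (2 * 2) 2 2 w ∧ w' = complexBetti.map g (2 * 2) w}

/-- **TABLE X, codimension 3 (census node, OURS, dimension 6 only):** on every complex abelian SIXFOLD outside the
residue class every rational `(3,3)`-class lies in the span of divisor monomials, of products (rational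
`(2,2)`-class)·(rational `(1,1)`-class), of pull-backs of rational `(3,3)`-classes from smaller dimension, and of
pull-backs of Weil classes of Weil-type sixfolds. Evidence: TABLE-X-g6-v0 (every exceptional `B³` outside the
residue is `W_k`, resp. `Σ_{k ⊂ D} W_k` for type III(1)). A definition (nothing asserted).
[cite: MoonenZarhin1999LowDim, Thm. 0.2 and §5] [cite: Weil1977HodgeRing] [status: open] -/
@[conjecture] def SixfoldCodimThreeCensus : Prop :=
  ∀ A : AbelianVariety ℂ, A.dim = 6 → ¬ (IsOfCMType A ∨ ProdCMCell IsQuarticFieldTypeIVFourfold (fun Z ↦ Z.dim = 2) A) → ∀ c : complexBetti A.X (2 * 3),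
    IsRationalClass c → IsOfHodgeType A.dim A.X (2 * 3) 3 3 c →
      c ∈ divisorClassesSpan A.X A.dim 3 ⊔ Submodule.span ℂ {w' : complexBetti A.X (2 * 3) |
          ∃ (a : complexBetti A.X (2 * 2)) (b : complexBetti A.X (2 * 1)),
            IsRationalClass a ∧ IsOfHodgeType A.dim A.X (2 * 2) 2 2 a ∧ IsRationalClass b ∧
            IsOfHodgeType A.dim A.X (2 * 1) 1 1 b ∧ w' = cupProduct (two_mul_add_two_mul 2 1) a b} ⊔
        Submodule.span ℂ {w' : complexBetti A.X (2 * 3) |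
          ∃ (C : AbelianVariety ℂ) (g : A.X ⟶ C.X) (w : complexBetti C.X (2 * 3)), C.dim < A.dim ∧
            IsRationalClass w ∧ IsOfHodgeType C.dim C.X (2 * 3) 3 3 w ∧ w' = complexBetti.map g (2 * 3) w} ⊔
        Submodule.span ℂ {w' : complexBetti A.X (2 * 3) |
          ∃ (B : AbelianVariety ℂ) (g : A.X ⟶ B.X) (d : ℕ) (ψ : B ⟶ B) (w : complexBetti B.X (2 * 3)),
            B.dim = 6 ∧ 0 < d ∧ ψ ≫ ψ = -(d • 𝟙 B) ∧ IsRationalClass w ∧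
            IsOfHodgeType B.dim B.X (2 * 3) 3 3 w ∧ w ∈ weilClassesOf B ψ 3 d ∧
            w' = complexBetti.map g (2 * 3) w}

/-! ## §1 The induction with bound `6` for an arbitrary granted class `𝒞` -/

section CensusOffSix

variable {𝒞 : AbelianVariety ℂ → Prop} (h𝒞 : HCOnClass fun A ↦ 𝒞 A ∧ A.dim = 6)
  (h₃ : ∀ A : AbelianVariety ℂ, A.dim = 6 → ¬ 𝒞 A → ∀ c : complexBetti A.X (2 * 2),
    IsRationalClass c → IsOfHodgeType A.dim A.X (2 * 2) 2 2 c →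
      c ∈ divisorClassesSpan A.X A.dim 2 ⊔ Submodule.span ℂ {w' : complexBetti A.X (2 * 2) |
        ∃ (C : AbelianVariety ℂ) (g : A.X ⟶ C.X) (w : complexBetti C.X (2 * 2)), C.dim < A.dim ∧
          IsRationalClass w ∧ IsOfHodgeType C.dim C.X (2 * 2) 2 2 w ∧ w' = complexBetti.map g (2 * 2) w})
  (h₂ : ∀ A : AbelianVariety ℂ, A.dim = 6 → ¬ 𝒞 A → ∀ c : complexBetti A.X (2 * 3),
    IsRationalClass c → IsOfHodgeType A.dim A.X (2 * 3) 3 3 c →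
      c ∈ divisorClassesSpan A.X A.dim 3 ⊔ Submodule.span ℂ {w' : complexBetti A.X (2 * 3) |
          ∃ (a : complexBetti A.X (2 * 2)) (b : complexBetti A.X (2 * 1)),
            IsRationalClass a ∧ IsOfHodgeType A.dim A.X (2 * 2) 2 2 a ∧ IsRationalClass b ∧
            IsOfHodgeType A.dim A.X (2 * 1) 1 1 b ∧ w' = cupProduct (two_mul_add_two_mul 2 1) a b} ⊔
        Submodule.span ℂ {w' : complexBetti A.X (2 * 3) |
          ∃ (C : AbelianVariety ℂ) (g : A.X ⟶ C.X) (w : complexBetti C.X (2 * 3)), C.dim < A.dim ∧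
            IsRationalClass w ∧ IsOfHodgeType C.dim C.X (2 * 3) 3 3 w ∧ w' = complexBetti.map g (2 * 3) w} ⊔
        Submodule.span ℂ {w' : complexBetti A.X (2 * 3) |
          ∃ (B : AbelianVariety ℂ) (g : A.X ⟶ B.X) (d : ℕ) (ψ : B ⟶ B) (w : complexBetti B.X (2 * 3)),
            B.dim = 6 ∧ 0 < d ∧ ψ ≫ ψ = -(d • 𝟙 B) ∧ IsRationalClass w ∧
            IsOfHodgeType B.dim B.X (2 * 3) 3 3 w ∧ w ∈ weilClassesOf B ψ 3 d ∧
            w' = complexBetti.map g (2 * 3) w})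
  (h₄ : ∀ (d : ℕ), 0 < d → ∀ (B : AbelianVariety ℂ) (ψ : B ⟶ B), B.dim = 6 → ψ ≫ ψ = -(d • 𝟙 B) → ¬ 𝒞 B →
    ∀ w : complexBetti B.X (2 * 3), IsRationalClass w → IsOfHodgeType B.dim B.X (2 * 3) 3 3 w →
      w ∈ weilClassesOf B ψ 3 d → w ∈ algebraicClasses B.X 3)
  (h₅ : HCUpToDim 5)

include h𝒞 h₃ h₂ h₄ h₅

/-- **The cycle part of HC in dimension `≤ 6` from: HC on `𝒞` in dimension `6`, the dimension-6 census OFF `𝒞`, the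
cell `W₆` OFF `𝒞`, the floor `HCUpToDim 5`** — `Ring2.ClassTargets.mem_algebraicClasses_of_dim_le_seven_of_censusOff` with the
bound `6` (the census hypotheses are demanded at dimension `6` only). [cite: MoonenZarhin1999LowDim, §5; arXiv:math/9901113]
[cite: VoisinHodgeI2002, Thms. 6.25, 11.30] -/
theorem mem_algebraicClasses_of_dim_le_six_of_censusOff :
    ∀ (n : ℕ) (A : AbelianVariety ℂ), A.dim = n → n ≤ 6 →
      ∀ (p : ℕ) (c : complexBetti A.X (2 * p)), IsRationalClass c →
        IsOfHodgeType A.dim A.X (2 * p) p p c → c ∈ algebraicClasses A.X p := by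
  intro n
  induction n using Nat.strong_induction_on with
  | _ n ih =>
  intro A hAn hn6
  have hX : IsSmoothProjective A.dim A.X := AbelianVariety.isSmoothProjective_holds
  by_cases h5 : A.dim ≤ 5
  · exact fun p c hc hct ↦ (h₅ A h5).2 p c hc hct
  have h6 : A.dim = 6 := by omega
  by_cases hA𝒞 : 𝒞 A
  · exact fun p c hc hct ↦ (h𝒞 A ⟨hA𝒞, h6⟩).2 p c hc hct
  have h11 : ∀ b : complexBetti A.X (2 * 1), IsRationalClass b →
      IsOfHodgeType A.dim A.X (2 * 1) 1 1 b → b ∈ algebraicClasses A.X 1 :=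
    fun b hb hbt ↦ lefschetzOneOne_rational_holds hX b hb hbt
  have hpull : ∀ (q : ℕ) (C : AbelianVariety ℂ) (g : A.X ⟶ C.X) (w : complexBetti C.X (2 * q)),
      C.dim < A.dim → IsRationalClass w → IsOfHodgeType C.dim C.X (2 * q) q q w →
        complexBetti.map g (2 * q) w ∈ algebraicClasses A.X q := by
    intro q C g w hC hw hwt
    have hwC : w ∈ algebraicClasses C.X q := ih C.dim (by omega) C rfl (by omega) q w hw hwt
    exact map_mem_algebraicClasses_of_abelianVariety hX C g hwC
  have hp2 : ∀ c : complexBetti A.X (2 * 2), IsRationalClass c →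
      IsOfHodgeType A.dim A.X (2 * 2) 2 2 c → c ∈ algebraicClasses A.X 2 := by
    intro c hc hct
    have hle : divisorClassesSpan A.X A.dim 2 ⊔ Submodule.span ℂ {w' : complexBetti A.X (2 * 2) |
        ∃ (C : AbelianVariety ℂ) (g : A.X ⟶ C.X) (w : complexBetti C.X (2 * 2)), C.dim < A.dim ∧
          IsRationalClass w ∧ IsOfHodgeType C.dim C.X (2 * 2) 2 2 w ∧
          w' = complexBetti.map g (2 * 2) w} ≤ algebraicClasses A.X 2 := by
      refine sup_le (AbelianVariety.divisorClassesSpan_le_algebraicClasses A h11 2) (Submodule.span_le.mpr ?_)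
      rintro _ ⟨C, g, w, hC, hw, hwt, rfl⟩
      exact hpull 2 C g w hC hw hwt
    exact hle (h₃ A h6 hA𝒞 c hc hct)
  have hp3 : ∀ c : complexBetti A.X (2 * 3), IsRationalClass c →
      IsOfHodgeType A.dim A.X (2 * 3) 3 3 c → c ∈ algebraicClasses A.X 3 := by
    intro c hc hct
    have hcup : Submodule.span ℂ {w' : complexBetti A.X (2 * 3) |
        ∃ (a : complexBetti A.X (2 * 2)) (b : complexBetti A.X (2 * 1)),
          IsRationalClass a ∧ IsOfHodgeType A.dim A.X (2 * 2) 2 2 a ∧ IsRationalClass b ∧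
          IsOfHodgeType A.dim A.X (2 * 1) 1 1 b ∧
          w' = cupProduct (two_mul_add_two_mul 2 1) a b} ≤ algebraicClasses A.X 3 := by
      refine Submodule.span_le.mpr ?_
      rintro _ ⟨a, b, ha, hat, hb, hbt, rfl⟩
      exact AbelianVariety.cupProduct_mem_algebraicClasses_one A (hp2 a ha hat) (h11 b hb hbt)
    have hlow3 : Submodule.span ℂ {w' : complexBetti A.X (2 * 3) |
        ∃ (C : AbelianVariety ℂ) (g : A.X ⟶ C.X) (w : complexBetti C.X (2 * 3)), C.dim < A.dim ∧
          IsRationalClass w ∧ IsOfHodgeType C.dim C.X (2 * 3) 3 3 w ∧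
          w' = complexBetti.map g (2 * 3) w} ≤ algebraicClasses A.X 3 := by
      refine Submodule.span_le.mpr ?_
      rintro _ ⟨C, g, w, hC, hw, hwt, rfl⟩
      exact hpull 3 C g w hC hw hwt
    have hweil3 : Submodule.span ℂ {w' : complexBetti A.X (2 * 3) |
        ∃ (B : AbelianVariety ℂ) (g : A.X ⟶ B.X) (d : ℕ) (ψ : B ⟶ B) (w : complexBetti B.X (2 * 3)),
          B.dim = 6 ∧ 0 < d ∧ ψ ≫ ψ = -(d • 𝟙 B) ∧ IsRationalClass w ∧
          IsOfHodgeType B.dim B.X (2 * 3) 3 3 w ∧ w ∈ weilClassesOf B ψ 3 d ∧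
          w' = complexBetti.map g (2 * 3) w} ≤ algebraicClasses A.X 3 := by
      refine Submodule.span_le.mpr ?_
      rintro _ ⟨B, g, d, ψ, w, hB, hd, hψ, hw, hwt, hweil, rfl⟩
      refine map_mem_algebraicClasses_of_abelianVariety hX B g ?_
      by_cases hB𝒞 : 𝒞 B
      · exact (h𝒞 B ⟨hB𝒞, hB⟩).2 3 w hw hwt
      · exact h₄ d hd B ψ hB hψ hB𝒞 w hw hwt hweil
    exact (sup_le (sup_le (sup_le (AbelianVariety.divisorClassesSpan_le_algebraicClasses A h11 3)
      hcup) hlow3) hweil3) (h₂ A h6 hA𝒞 c hc hct)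
  have hlow : ∀ p : ℕ, 2 * p ≤ A.dim → ∀ c : complexBetti A.X (2 * p), IsRationalClass c →
      IsOfHodgeType A.dim A.X (2 * p) p p c → c ∈ algebraicClasses A.X p := by
    intro p hp c hc hct
    have hp3' : p ≤ 3 := by omega
    interval_cases p
    · exact hodgeConjectureFor_codim_zero c
    · exact h11 c hc hct
    · exact hp2 c hc hct
    · exact hp3 c hc hct
  intro p c hc hct
  by_cases hp : 2 * p ≤ A.dim
  · exact hlow p hp c hc hct
  · exact mem_algebraicClasses_of_lt_of_nonempty (nonempty_hardLefschetzNFold_holds A.dim A.X) hX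
      (by omega) (hlow (A.dim - p) (by omega)) c hc hct

/-- **Rows `≤ 6` from: HC on `𝒞` in dimension `6`, the dimension-6 census OFF `𝒞`, `W₆` OFF `𝒞`, the floor.**
[cite: MoonenZarhin1999LowDim, §5; arXiv:math/9901113] -/
theorem hcUpToDim_six_of_censusOff : HCUpToDim 6 := fun A hA ↦
  ⟨nonempty_hodgeModel_holds AbelianVariety.isSmoothProjective_holds,
    mem_algebraicClasses_of_dim_le_six_of_censusOff h𝒞 h₃ h₂ h₄ h₅ A.dim A rfl hA⟩

end CensusOffSix

/-! ## §2 Instantiation: `𝒞 = CM ∪ K3P`, floor by Markman, `W₆` by the rung H2 -/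

/-- `HC_CM` (binder, by name) and HC on the K3-partner cell give HC on the residue class.
[cite: Milne1999, §7 (H)] [cite: MoonenZarhin1999LowDim, §5 Case 2] -/
theorem hcOnClass_residueClass (hCM : Theses.RankFourFaces.CMAbelianHodge)
    (hK3P : HodgeQuarticTypeIVFourfoldTimesCMSurface) :
    HCOnClass fun A ↦ IsOfCMType A ∨ ProdCMCell IsQuarticFieldTypeIVFourfold (fun Z ↦ Z.dim = 2) A :=
  hcOnClass_or_iff.mpr ⟨hcOnClass_cmType_of_hcCM hCM, hK3P⟩

/-- The residue class in dimension `6` (what §1 consumes). [cite: Milne1999, §7 (H)] -/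
theorem hcOnClass_residueClass_six (hCM : Theses.RankFourFaces.CMAbelianHodge)
    (hK3P : HodgeQuarticTypeIVFourfoldTimesCMSurface) :
    HCOnClass fun A ↦ (IsOfCMType A ∨ ProdCMCell IsQuarticFieldTypeIVFourfold (fun Z ↦ Z.dim = 2) A) ∧ A.dim = 6 :=
  hcOnClass_mono (fun _ h ↦ h.1) (hcOnClass_residueClass hCM hK3P)

/-- **TABLE X COVER (dimension 6).** GRANTED Markman's fourfold theorem (floor `dim ≤ 5`), the binder `HC_CM`, HC on
the K3-partner cell (residue R-K3P, OPEN), the Weil classes of abelian sixfolds (`WeilSixfolds`, residue R-W6 = rung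
H2 off the hyperbolic components, OPEN) and the two dimension-6 census nodes of TABLE X (OURS, not print), the Hodge
conjecture holds for every complex abelian variety of dimension `6`. Nothing here is a corollary of `HC_CM` alone and
none of the hypotheses is asserted. [cite: MoonenZarhin1999LowDim, Thms. 0.1–0.2, §5] [claim: Markman2025SurveySecant, status: under-review]
[cite: Markman2025SecantWeil, Thm. 1.5.1] -/
theorem hcAtDim_six_of_tableX (hMark : Markman2025_weilClasses_algebraic_abelianFourfold)
    (hCM : Theses.RankFourFaces.CMAbelianHodge) (hK3P : HodgeQuarticTypeIVFourfoldTimesCMSurface)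
    (hW₆ : Theses.SevenfoldWeilCensus.WeilSixfolds)
    (hX2 : SixfoldCodimTwoCensus) (hX1 : SixfoldCodimThreeCensus) : HCAtDim 6 :=
  hcAtDim_of_hcUpToDim (hcUpToDim_six_of_censusOff
    (𝒞 := fun A ↦ IsOfCMType A ∨ ProdCMCell IsQuarticFieldTypeIVFourfold (fun Z ↦ Z.dim = 2) A)
    (hcOnClass_residueClass_six hCM hK3P) hX2 hX1
    (weilSixfoldsOff_of_weilSixfolds _ hW₆) (Ring2.RowFourClosed.hcUpToDim_five_of_markman hMark))

/-- Same, as `HCUpToDim 6` (rows `≤ 6`). [cite: MoonenZarhin1999LowDim, Thms. 0.1–0.2, §5] -/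
theorem hcUpToDim_six_of_tableX (hMark : Markman2025_weilClasses_algebraic_abelianFourfold)
    (hCM : Theses.RankFourFaces.CMAbelianHodge) (hK3P : HodgeQuarticTypeIVFourfoldTimesCMSurface)
    (hW₆ : Theses.SevenfoldWeilCensus.WeilSixfolds)
    (hX2 : SixfoldCodimTwoCensus) (hX1 : SixfoldCodimThreeCensus) : HCUpToDim 6 :=
  hcUpToDim_six_of_censusOff
    (𝒞 := fun A ↦ IsOfCMType A ∨ ProdCMCell IsQuarticFieldTypeIVFourfold (fun Z ↦ Z.dim = 2) A)
    (hcOnClass_residueClass_six hCM hK3P) hX2 hX1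
    (weilSixfoldsOff_of_weilSixfolds _ hW₆) (Ring2.RowFourClosed.hcUpToDim_five_of_markman hMark)

/-- **TABLE X COVER, RESIDUES NAMED (dimension 6).** GRANTED the two Markman facts (fourfolds: floor `dim ≤ 5`;
hyperbolic sixfolds: the printed Weil range, UNREFEREED), the binder `HC_CM`, and the three residues of TABLE X —
R-K3P (`HodgeQuarticTypeIVFourfoldTimesCMSurface`), R-W6 (`WeilTypeLadder.NonsplitSixfolds`: the NON-hyperbolic Weil
sixfold components, every `K`) — plus the two dimension-6 census nodes (OURS), the Hodge conjecture holds for every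
complex abelian variety of dimension `6`. None of the hypotheses is asserted; nothing is a corollary of `HC_CM` alone.
[cite: MoonenZarhin1999LowDim, Thms. 0.1–0.2, §5] [cite: Markman2025SecantWeil, Thm. 1.5.1 (preprint, unrefereed)]
[claim: Markman2025SurveySecant, status: under-review] [cite: vanGeemen1994HodgeAV, (5.4.1)] -/
theorem hcAtDim_six_of_tableX_residues (hMark₄ : Markman2025_weilClasses_algebraic_abelianFourfold)
    (hMark₆ : Markman2025_weilClasses_algebraic_hyperbolicSixfold)
    (hCM : Theses.RankFourFaces.CMAbelianHodge) (hK3P : HodgeQuarticTypeIVFourfoldTimesCMSurface)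
    (hRW6 : WeilTypeLadder.NonsplitSixfolds)
    (hX2 : SixfoldCodimTwoCensus) (hX1 : SixfoldCodimThreeCensus) : HCAtDim 6 :=
  hcAtDim_six_of_tableX hMark₄ hCM hK3P (WeilTypeLadder.weilSixfolds_of_nonsplitSixfolds_of_floor hMark₆ hRW6) hX2 hX1

/-! ## §2b TABLE X row 15: the binder `HC_CM` narrowed to the NON-SIMPLE CM sixfolds -/

/-- **The residue class in dimension `6` WITHOUT `HC_CM` on the simple CM sixfolds**: from Markman's hyperbolic-sixfold
statement, the displayed CM-splitness hypothesis `hS` (verbatim the hypothesis of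
`CorCM.CMSixfoldSplit.hodgeSimpleCMSixfold_of_markmanSixfolds_of_cmSplit`; print-level proof = COR-CM note CM-WEIL-SPLIT
Theorem A, not refereed, not a kernel theorem), the displayed binder HC for the NON-SIMPLE CM sixfolds (TABLE X row 29),
and HC on the K3-partner cell. [cite: Markman2025SecantWeil, Thm. 1.5.1 (preprint, unrefereed)]
[cite: vanGeemen1994HodgeAV, Lemma 5.2, 5.4 and (5.4.1)] [cite: MoonenZarhin1999LowDim, §5] -/
theorem hcOnClass_residueClass_six_of_cmSplit (hMark₆ : Markman2025_weilClasses_algebraic_hyperbolicSixfold)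
    (hS : ∀ (A : AbelianVariety ℂ) (φ : A ⟶ A) (d : ℕ), IsSimpleCMSixfold A → IsWeilType A φ 3 d →
      ∃ (e : ProjectiveEmbedding A.X) (a : complexBetti (projectiveSpace e.n ℂ) 2),
        IsRationalClass a ∧ a ≠ 0 ∧
          HasWeilDiscriminantNondeg A φ 3 d
            ((d : ℂ) • complexBetti.map e.ι 2 a + complexBetti.map φ.hom.hom.hom 2 (complexBetti.map e.ι 2 a))
            (splitDiscriminantClass 3 d))
    (hCMns : HCOnClass fun A ↦ A.dim = 6 ∧ IsOfCMType A ∧ ¬ A.IsSimple)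
    (hK3P : HodgeQuarticTypeIVFourfoldTimesCMSurface) :
    HCOnClass fun A ↦ (IsOfCMType A ∨ ProdCMCell IsQuarticFieldTypeIVFourfold (fun Z ↦ Z.dim = 2) A) ∧ A.dim = 6 := by
  rintro A ⟨hA | hA, h6⟩
  · by_cases hs : A.IsSimple
    · exact CorCM.CMSixfoldSplit.hodgeSimpleCMSixfold_of_markmanSixfolds_of_cmSplit hMark₆ hS A ⟨h6, hs, hA⟩
    · exact hCMns A ⟨h6, hA, hs⟩
  · exact hK3P A hA

/-- **TABLE X COVER WITH THE CM BINDER NARROWED (dimension 6).** GRANTED the two Markman facts (fourfolds; hyperbolic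
sixfolds, UNREFEREED), the CM-splitness hypothesis `hS` (displayed; note-level), HC for the NON-SIMPLE complex abelian
sixfolds of CM type (displayed binder; TABLE X row 29), R-K3P, R-W6 = `WeilTypeLadder.NonsplitSixfolds`, and the two
dimension-6 census nodes (OURS), the Hodge conjecture holds for every complex abelian variety of dimension `6`. The
simple CM sixfolds (TABLE X rows 14–15) no longer enter through `HC_CM`. None of the hypotheses is asserted; `HC_CM` is
NOT proved. [cite: MoonenZarhin1999LowDim, Thms. 0.1–0.2, §5] [cite: Markman2025SecantWeil, Thm. 1.5.1 (preprint, unrefereed)]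
[claim: Markman2025SurveySecant, status: under-review] [cite: vanGeemen1994HodgeAV, Lemma 5.2, (5.4.1)] -/
theorem hcAtDim_six_of_tableX_cmSplit (hMark₄ : Markman2025_weilClasses_algebraic_abelianFourfold)
    (hMark₆ : Markman2025_weilClasses_algebraic_hyperbolicSixfold)
    (hS : ∀ (A : AbelianVariety ℂ) (φ : A ⟶ A) (d : ℕ), IsSimpleCMSixfold A → IsWeilType A φ 3 d →
      ∃ (e : ProjectiveEmbedding A.X) (a : complexBetti (projectiveSpace e.n ℂ) 2),
        IsRationalClass a ∧ a ≠ 0 ∧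
          HasWeilDiscriminantNondeg A φ 3 d
            ((d : ℂ) • complexBetti.map e.ι 2 a + complexBetti.map φ.hom.hom.hom 2 (complexBetti.map e.ι 2 a))
            (splitDiscriminantClass 3 d))
    (hCMns : HCOnClass fun A ↦ A.dim = 6 ∧ IsOfCMType A ∧ ¬ A.IsSimple)
    (hK3P : HodgeQuarticTypeIVFourfoldTimesCMSurface) (hRW6 : WeilTypeLadder.NonsplitSixfolds)
    (hX2 : SixfoldCodimTwoCensus) (hX1 : SixfoldCodimThreeCensus) : HCAtDim 6 :=
  hcAtDim_of_hcUpToDim (hcUpToDim_six_of_censusOff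
    (𝒞 := fun A ↦ IsOfCMType A ∨ ProdCMCell IsQuarticFieldTypeIVFourfold (fun Z ↦ Z.dim = 2) A)
    (hcOnClass_residueClass_six_of_cmSplit hMark₆ hS hCMns hK3P) hX2 hX1
    (weilSixfoldsOff_of_weilSixfolds _
      (WeilTypeLadder.weilSixfolds_of_nonsplitSixfolds_of_floor hMark₆ hRW6))
    (Ring2.RowFourClosed.hcUpToDim_five_of_markman hMark₄))

/-! ## §3 Audit: on-path -/

/-- Audit: the conclusion is a case of the summit (so is every HC-shaped hypothesis); the census nodes are
Hodge-theoretic classification statements, NOT consequences of `HodgeConjecture`, and are never asserted.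
[cite: Deligne2000, §1] -/
theorem hcAtDim_six_of_hodgeConjecture (h : _root_.HodgeConjecture) : HCAtDim 6 :=
  hcOnClass_of_hodgeConjecture _ h

end Summit.HodgeConjecture.HodgeConjecture.TableX
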